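import Literature.AlgebraicGeometry.ModuliOfAbelianVarieties.SiegelCMSpecialPairPeriodIso
import Literature.NumberTheory.ComplexMultiplication.CMTypeUniformization
import Literature.AlgebraicGeometry.Motives.ComplexTorusHomOfLinearMap
import Literature.Geometry.Kaehler.ComplexTorusOfComplexStructure
import HarnessLib

/-!
# Torus maps between a marked special point of the Siegel datum and a principal CM structure of one factor
# ([Deligne 1971] 4.19; [Shimura 1998] §7.4 Prop. 15 «`S(γ)` represents a homomorphism»; [Milne ISV] 14.12)

Topic `AlgebraicGeometry/ModuliOfAbelianVarieties`; namespace `Literature.AlgebraicGeometry.ModuliOfAbelianVarieties.CMStructure`.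
THEOREMS ONLY (no definition, no named fact, no instance, no `sorry`; net Literature debt 0).  Cell `hodgecm-mathlib`
(D-0151), #60 road / Mumford line: piece **M3a-α** of CENSUS-M3a (A-p06) = the two «torus maps» inside B-plan1's stub
`stub_cmConjugationIsogeny` (ROUTE ξ′): the homomorphisms `χᵢ : B ⟶ Aᵢ` (down to a PRINCIPAL `(Kᵢ, Φᵢ, 𝔟)`-structure) and
`θᵢ : Aᵢ′ ⟶ B′` (up from a principal structure, with an integer `M`) attached to a special point `[J, a]` whose marked
variety `B` is read through the period isomorphism `e : ℝ^{2g} ≃ ∏ᵢ ℂ^{Φᵢ}` of the special pair (★ R60-33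
`IsSpecial.exists_periodIso`).  The MARKING enters only through its raw chart data `(γ, Ψ, φ_B)` and the two compatibilities
`Ψ(γ⁻¹Jx) = √−1·Ψ(γ⁻¹x)`, `e(Jv) = √−1·e(v)` — so the file is independent of the (not yet filed) T1′ carrier
`SiegelAdelicMarking`, whose fields `m.γ, m.Ψ, m.Ψ_J, m.toFun, m.isAnalytification` instantiate it literally, `m.r v` being
`m.toFun (proj m.Ψ (fun j => ((m.γ⁻¹ *ᵥ v) j : ℝ)))`.

## What is proved

For a CM structure `c` on `(ℚ^{2g}, ψ_δ)` (★ `CMStructure`), CM types `Φ`, an `ℝ`-linear `e : ℝ^{2g} ≃ ∏ᵢ ℂ^{Φᵢ}` with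
`e(act(x)·v₀) = (cmEmbedding (Φ i) (x i))ᵢ` (the rational structure read in `F = ∏Kᵢ`, ★ R60-33 (c)) and `e ∘ J = √−1 • e`
(★ R60-33 (a)), chart data `γ ∈ GL_{2g}(ℚ)`, `Ψ : ℝ^{2g} ≃L[ℝ] ℂ^g` with `Ψ(γ⁻¹Jx) = √−1·Ψ(γ⁻¹x)`, and an analytification
`φ_B : ℂ^g/Ψ(ℤ^{2g}) → B(ℂ)` of a complex abelian variety over the origin:
* §1 `exists_hom_map_chart_eq_r` (DOWN): if every lattice vector `γ eₖ` is `act(xₖ)·v₀` with `(xₖ)ᵢ ∈ 𝔟`, then for every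
  principal `ξ : CMTypeUniformization (Φ i) 𝔟 A ι` there is `χ : B ⟶ A` with
  **`χ(φ_B(π_Ψ(γ⁻¹·act(x)v₀))) = ξ.r (x i)`** for all `x ∈ F`;
* §2 `exists_hom_map_r_eq_chart` (UP): if `γ⁻¹·act(eᵢ(M·y))v₀ ∈ ℤ^{2g}` for every `y ∈ 𝔟′`, then for every principal
  `ξ′ : CMTypeUniformization (Φ i) 𝔟′ A′ ι′` (e.g. Shimura's `ξ′` on a conjugate `Aᵢ^σ`) there is `θ : A′ ⟶ B` with
  **`θ(ξ′.r y) = φ_B(π_Ψ(γ⁻¹·act(eᵢ(M·y))v₀))`** for all `y ∈ Kᵢ`.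
Both are ONE application of ★ `AbelianVariety.exists_hom_map_cover_eq` (Lange–Birkenhake Prop. 1.2.1 + Cor. 2.1.17) to the
`ℂ`-linear maps `prᵢ ∘ e ∘ γ ∘ Ψ⁻¹` and `Ψ ∘ γ⁻¹ ∘ e⁻¹ ∘ inclᵢ ∘ (M·)` (★ `Kaehler.toComplexLinear`), the lattice conditions
being read through ★ `periodIso_single` / `exists_intVec_of_mem_idealLattice` and Shimura's `r = ξ ∘ q` through
★ `CMTypeUniformization.r_apply`.

## References
* [Deligne1971TravauxShimura] P. Deligne, *Travaux de Shimura* (1971), 4.19–4.21 pp. 151–152.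
* [Shimura1998] G. Shimura, *Abelian Varieties with Complex Multiplication and Modular Functions* (1998), §7.4 Prop. 15 p. 53;
  §18.6 Thm. 18.6 (2) pp. 124–125.
* [Milne2005ShimuraVarieties] J. S. Milne, *Introduction to Shimura varieties* (2005), Ex. 12.4 (b) p. 112; Prop. 14.12 p. 125.
* [LangeBirkenhake1992] H. Lange, Ch. Birkenhake, *Complex Abelian Varieties* (1992), Ch. 1 §1.2 Prop. 1.2.1; Ch. 2 Cor. 2.1.17.
-/

noncomputable section

open scoped Classical nonZeroDivisors
open Matrix NumberField Module CategoryTheory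
open Literature.Geometry.Kaehler Literature.Geometry.Kaehler.ComplexTorus
open Literature.NumberTheory.Transcendental (IsAnalytification)
open Literature.NumberTheory.ComplexMultiplication Literature.NumberTheory.ComplexMultiplication.CMTypeLattice
open Literature.AlgebraicGeometry.Motives (CMType AbelianVariety AlgPoints)

namespace Literature.AlgebraicGeometry.ModuliOfAbelianVarieties

namespace CMStructure

variable {g : ℕ} {δ : Fin g → ℕ} {ι : Type} [Fintype ι] [DecidableEq ι] {K : ι → Type} [∀ i, Field (K i)]
  [∀ i, NumberField (K i)] [∀ i, IsCMField (K i)]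
  (c : CMStructure g δ ι K) (Φ : ∀ i, CMType (K i))
  {e : (Fin g ⊕ Fin g → ℝ) ≃ₗ[ℝ] (Π i, ((Φ i).1 → ℂ))} {v₀ : Fin g ⊕ Fin g → ℚ}
  {J : Matrix (Fin g ⊕ Fin g) (Fin g ⊕ Fin g) ℝ}
  {γ : GL (Fin g ⊕ Fin g) ℚ} {Ψ : (Fin g ⊕ Fin g → ℝ) ≃L[ℝ] (Fin g → ℂ)}
  {B : AbelianVariety ℂ} {φB : ComplexTorus Ψ → B.Points ℂ}

/-! ### §0 Coordinates -/

/-- `γ̂ · γ̂⁻¹ = 1` for the real matrices of `γ ∈ GL_{2g}(ℚ)`. [folklore] -/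
private theorem realMat_mul_realMat_inv (γ : GL (Fin g ⊕ Fin g) ℚ) :
    ((γ : Matrix (Fin g ⊕ Fin g) (Fin g ⊕ Fin g) ℚ).map (algebraMap ℚ ℝ)) *
        (((γ⁻¹ : GL (Fin g ⊕ Fin g) ℚ) : Matrix (Fin g ⊕ Fin g) (Fin g ⊕ Fin g) ℚ).map (algebraMap ℚ ℝ)) = 1 := by
  rw [← Matrix.map_mul, ← Units.val_mul, mul_inv_cancel, Units.val_one, Matrix.map_one _ (map_zero _) (map_one _)]

/-- `γ̂⁻¹ · γ̂ = 1`. [folklore] -/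
private theorem realMat_inv_mul_realMat (γ : GL (Fin g ⊕ Fin g) ℚ) :
    (((γ⁻¹ : GL (Fin g ⊕ Fin g) ℚ) : Matrix (Fin g ⊕ Fin g) (Fin g ⊕ Fin g) ℚ).map (algebraMap ℚ ℝ)) *
        ((γ : Matrix (Fin g ⊕ Fin g) (Fin g ⊕ Fin g) ℚ).map (algebraMap ℚ ℝ)) = 1 := by
  rw [← Matrix.map_mul, ← Units.val_mul, inv_mul_cancel, Units.val_one, Matrix.map_one _ (map_zero _) (map_one _)]

/-- The real vector of `N *ᵥ w` is `N̂ *ᵥ ŵ` (`algebraMap ℚ ℝ` commutes with `mulVec`). [folklore] -/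
private theorem realVec_mulVec (N : Matrix (Fin g ⊕ Fin g) (Fin g ⊕ Fin g) ℚ) (w : Fin g ⊕ Fin g → ℚ) :
    (fun j => ((N *ᵥ w) j : ℝ)) = N.map (algebraMap ℚ ℝ) *ᵥ fun j => (w j : ℝ) := by
  funext j
  simp only [Matrix.mulVec, dotProduct, Matrix.map_apply, eq_ratCast, Rat.cast_sum, Rat.cast_mul]

omit [DecidableEq ι] in
/-- The rational structure read in `F`, coordinatewise: `(e(act(x)·v₀))ᵢ = cmEmbedding (x i)`. [cite: Milne2005ShimuraVarieties, Ex. 12.4 (b) p. 112] -/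
private theorem e_realVec_act_apply
    (hv₀ : ∀ x : Π i, K i, e ((algebraMap ℚ ℝ) ∘ (c.act x v₀)) = fun i => cmEmbedding (Φ i) (x i))
    (x : Π i, K i) (i : ι) : e (fun j => (c.act x v₀ j : ℝ)) i = cmEmbedding (Φ i) (x i) := by
  have h : (fun j => (c.act x v₀ j : ℝ)) = (algebraMap ℚ ℝ) ∘ (c.act x v₀) := by
    funext j; exact (eq_ratCast _ _).symm
  rw [h, hv₀ x]

/-- The `i`-th coordinate line of `∏ⱼ ℂ^{Φⱼ}` read back in `V_ℝ`: `e⁻¹(ιᵢ(cmEmbedding y)) = act(eᵢ y)·v₀`.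
[cite: Milne2005ShimuraVarieties, Ex. 12.4 (b) p. 112] -/
private theorem e_symm_single_cmEmbedding
    (hv₀ : ∀ x : Π i, K i, e ((algebraMap ℚ ℝ) ∘ (c.act x v₀)) = fun i => cmEmbedding (Φ i) (x i))
    (i : ι) (y : K i) :
    e.symm (Pi.single i (cmEmbedding (Φ i) y)) = fun j => (c.act (Pi.single i y) v₀ j : ℝ) := by
  apply e.injective
  rw [LinearEquiv.apply_symm_apply]
  have h : (fun j => (c.act (Pi.single i y) v₀ j : ℝ)) = (algebraMap ℚ ℝ) ∘ (c.act (Pi.single i y) v₀) := by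
    funext j; exact (eq_ratCast _ _).symm
  rw [h, hv₀]
  funext j
  by_cases hj : j = i
  · subst hj; rw [Pi.single_eq_same, Pi.single_eq_same]
  · rw [Pi.single_eq_of_ne hj, Pi.single_eq_of_ne hj, map_zero]

/-! ### §1 DOWN: `χ : B ⟶ A` onto a principal structure of the factor `Kᵢ` -/

omit [DecidableEq ι] in
/-- **The projection of a marked special point onto a principal CM structure of one factor.**  Let `(γ, Ψ, φ_B)` be chart data
of a complex abelian variety `B` at the special point (`φ_B : ℂ^g/Ψ(ℤ^{2g}) → B(ℂ)` an analytification over the origin, the lattice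
being `γℤ^{2g} ⊂ ℚ^{2g}`, `Ψ(γ⁻¹Jx) = √−1 Ψ(γ⁻¹x)`), `e` the period isomorphism of the CM structure (`e(act x v₀) = (v_{Φⱼ}(xⱼ))ⱼ`,
`e J = √−1 e`), `i` a factor and `ξ` a principal uniformised structure of type `(Kᵢ, Φᵢ, 𝔟)`.  If the lattice projects into `𝔟`
— every `γeₖ = act(xₖ)v₀` with `(xₖ)ᵢ ∈ 𝔟` — then the `ℂ`-linear map `prᵢ ∘ e ∘ γ ∘ Ψ⁻¹` carries `Ψ(ℤ^{2g})` into `v(𝔟)` and is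
induced by a homomorphism `χ : B ⟶ A` with `χ(φ_B(π(γ⁻¹·act(x)v₀))) = ξ.r(xᵢ)` (Shimura: `r = ξ ∘ q`).
[cite: Shimura1998, §7.4 Prop. 15, p. 53] [cite: Deligne1971TravauxShimura, 4.19 p. 151] [cite: LangeBirkenhake1992, Ch. 1 §1.2 Prop. 1.2.1] -/
theorem exists_hom_map_chart_eq_r
    (hv₀ : ∀ x : Π i, K i, e ((algebraMap ℚ ℝ) ∘ (c.act x v₀)) = fun i => cmEmbedding (Φ i) (x i))
    (heJ : ∀ v, e (J *ᵥ v) = Complex.I • e v)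
    (hΨJ : ∀ x : Fin g ⊕ Fin g → ℝ,
      Ψ ((((γ⁻¹ : GL (Fin g ⊕ Fin g) ℚ) : Matrix _ _ ℚ).map (algebraMap ℚ ℝ)) *ᵥ (J *ᵥ x)) =
        Complex.I • Ψ ((((γ⁻¹ : GL (Fin g ⊕ Fin g) ℚ) : Matrix _ _ ℚ).map (algebraMap ℚ ℝ)) *ᵥ x))
    (hφB : IsAnalytification (Fin g → ℂ) B.X B.dim φB) (hφB0 : φB 0 = 1)
    (i : ι) {𝔟 : (FractionalIdeal (𝓞 (K i))⁰ (K i))ˣ} {A : AbelianVariety ℂ} {ιA : 𝓞 (K i) →+* End A}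
    (ξ : CMTypeUniformization (Φ i) 𝔟 A ιA)
    (hdown : ∀ k : Fin g ⊕ Fin g, ∃ x : Π i, K i,
      c.act x v₀ = (fun j => (γ : Matrix _ _ ℚ) j k) ∧ x i ∈ ((𝔟 : FractionalIdeal (𝓞 (K i))⁰ (K i)) : Set (K i))) :
    ∃ χ : B ⟶ A, ∀ x : Π i, K i,
      AlgPoints.map χ.hom.hom.hom
          (φB (proj Ψ fun j => ((((γ⁻¹ : GL (Fin g ⊕ Fin g) ℚ) : Matrix _ _ ℚ) *ᵥ c.act x v₀) j : ℝ))) =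
        ξ.r (x i) := by
  -- notation
  set γR : Matrix (Fin g ⊕ Fin g) (Fin g ⊕ Fin g) ℝ := (γ : Matrix _ _ ℚ).map (algebraMap ℚ ℝ) with hγR
  set γiR : Matrix (Fin g ⊕ Fin g) (Fin g ⊕ Fin g) ℝ :=
    ((γ⁻¹ : GL (Fin g ⊕ Fin g) ℚ) : Matrix _ _ ℚ).map (algebraMap ℚ ℝ) with hγiR
  -- the real-linear lift `L = prᵢ ∘ e ∘ γ ∘ Ψ⁻¹`
  let L : (Fin g → ℂ) →ₗ[ℝ] ((Φ i).1 → ℂ) :=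
    (LinearMap.proj i).comp (e.toLinearMap.comp ((Matrix.mulVecLin γR).comp Ψ.symm.toLinearEquiv.toLinearMap))
  have hL : ∀ z, L z = e (γR *ᵥ Ψ.symm z) i := fun z => rfl
  -- `L` commutes with `√−1`
  have hI : ∀ z, L.toContinuousLinearMap (Complex.I • z) = Complex.I • L.toContinuousLinearMap z := by
    intro z
    rw [LinearMap.coe_toContinuousLinearMap', hL, hL]
    -- `Ψ⁻¹(i z) = γ⁻¹ J γ Ψ⁻¹ z`
    have h1 : Ψ.symm (Complex.I • z) = γiR *ᵥ (J *ᵥ (γR *ᵥ Ψ.symm z)) := by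
      apply Ψ.injective
      rw [ContinuousLinearEquiv.apply_symm_apply, hΨJ, Matrix.mulVec_mulVec, realMat_inv_mul_realMat, Matrix.one_mulVec,
        ContinuousLinearEquiv.apply_symm_apply]
    rw [h1, Matrix.mulVec_mulVec, realMat_mul_realMat_inv, Matrix.one_mulVec, heJ, Pi.smul_apply]
  set T : (Fin g → ℂ) →L[ℂ] ((Φ i).1 → ℂ) := toComplexLinear L.toContinuousLinearMap hI with hT
  have hTz : ∀ z, T z = e (γR *ᵥ Ψ.symm z) i := fun z => by
    rw [hT, toComplexLinear_apply, LinearMap.coe_toContinuousLinearMap', hL]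
  -- `T` on a chart vector: `T (Ψ (γ⁻¹ v)) = (e v)ᵢ`
  have hTchart : ∀ w : Fin g ⊕ Fin g → ℚ,
      T (Ψ fun j => ((((γ⁻¹ : GL (Fin g ⊕ Fin g) ℚ) : Matrix _ _ ℚ) *ᵥ w) j : ℝ)) = e (fun j => (w j : ℝ)) i := by
    intro w
    rw [hTz, ContinuousLinearEquiv.symm_apply_apply, realVec_mulVec, ← hγiR, Matrix.mulVec_mulVec, realMat_mul_realMat_inv,
      Matrix.one_mulVec]
  -- the lattice condition: `T (Ψ eₖ) = (e (γ eₖ))ᵢ = v((xₖ)ᵢ) ∈ D(𝔟)`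
  have hTlat : ∀ k : Fin g ⊕ Fin g, ∃ z : basisIndex 𝔟 → ℤ, T (Ψ (Pi.single k 1)) = latticeVec (periodIso (Φ i) 𝔟) z := by
    intro k
    obtain ⟨x, hx, hxi⟩ := hdown k
    have hk : T (Ψ (Pi.single k 1)) = cmEmbedding (Φ i) (x i) := by
      rw [hTz, ContinuousLinearEquiv.symm_apply_apply, Matrix.mulVec_single_one, ← e_realVec_act_apply c Φ hv₀ x i, hx]
      rfl
    obtain ⟨m, hm⟩ := exists_intVec_of_mem_idealLattice (Φ i) 𝔟
      (cmEmbedding_mem_idealLattice (Φ i) 𝔟 hxi)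
    exact ⟨m, by rw [hk, ← hm]; rfl⟩
  -- the homomorphism
  obtain ⟨χ, hχ⟩ := AbelianVariety.exists_hom_map_cover_eq hφB ξ.isAnalytification hφB0 ξ.toFun_zero T hTlat
  refine ⟨χ, fun x => ?_⟩
  rw [← cover_apply_apply, hχ, hTchart, e_realVec_act_apply c Φ hv₀ x i, CMTypeUniformization.r_apply]

/-! ### §2 UP: `θ : A′ ⟶ B` from a principal structure of the factor `Kᵢ`, with an integer `M` -/

/-- **The inclusion of a principal CM structure of one factor into a marked special point, scaled by `M`.**  With the chart data and
period isomorphism as in §1 and a principal `ξ′` of type `(Kᵢ, Φᵢ, 𝔟′)` on ANY complex abelian variety `A′` (e.g. Shimura's `ξ′` on a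
conjugate `Aᵢ^σ`, ★ `shimura1998_thm18_6_of_isArtinCorrespondent`): if `γ⁻¹·act(eᵢ(M·y))v₀ ∈ ℤ^{2g}` for every `y ∈ 𝔟′` (the
scaled factor lattice lies in the marking's lattice), the `ℂ`-linear map `Ψ ∘ γ⁻¹ ∘ e⁻¹ ∘ ιᵢ ∘ (M·)` is induced by a homomorphism
`θ : A′ ⟶ B` with `θ(ξ′.r y) = φ_B(π(γ⁻¹·act(eᵢ(M y))v₀))` for all `y ∈ Kᵢ`.
[cite: Shimura1998, §7.4 Prop. 15, p. 53; §18.6 Thm. 18.6 (2), pp. 124–125] [cite: Deligne1971TravauxShimura, 4.19 p. 151]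
[cite: LangeBirkenhake1992, Ch. 1 §1.2 Prop. 1.2.1] -/
theorem exists_hom_map_r_eq_chart
    (hv₀ : ∀ x : Π i, K i, e ((algebraMap ℚ ℝ) ∘ (c.act x v₀)) = fun i => cmEmbedding (Φ i) (x i))
    (heJ : ∀ v, e (J *ᵥ v) = Complex.I • e v)
    (hΨJ : ∀ x : Fin g ⊕ Fin g → ℝ,
      Ψ ((((γ⁻¹ : GL (Fin g ⊕ Fin g) ℚ) : Matrix _ _ ℚ).map (algebraMap ℚ ℝ)) *ᵥ (J *ᵥ x)) =
        Complex.I • Ψ ((((γ⁻¹ : GL (Fin g ⊕ Fin g) ℚ) : Matrix _ _ ℚ).map (algebraMap ℚ ℝ)) *ᵥ x))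
    (hφB : IsAnalytification (Fin g → ℂ) B.X B.dim φB) (hφB0 : φB 0 = 1)
    (i : ι) {𝔟' : (FractionalIdeal (𝓞 (K i))⁰ (K i))ˣ} {A' : AbelianVariety ℂ} {ιA' : 𝓞 (K i) →+* End A'}
    (ξ' : CMTypeUniformization (Φ i) 𝔟' A' ιA') (M : ℕ)
    (hup : ∀ y : K i, y ∈ ((𝔟' : FractionalIdeal (𝓞 (K i))⁰ (K i)) : Set (K i)) →
      ∃ z : Fin g ⊕ Fin g → ℤ,
        (((γ⁻¹ : GL (Fin g ⊕ Fin g) ℚ) : Matrix _ _ ℚ) *ᵥ c.act (Pi.single i ((M : K i) * y)) v₀) = fun j => (z j : ℚ)) :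
    ∃ θ : A' ⟶ B, ∀ y : K i,
      AlgPoints.map θ.hom.hom.hom (ξ'.r y) =
        φB (proj Ψ fun j =>
          ((((γ⁻¹ : GL (Fin g ⊕ Fin g) ℚ) : Matrix _ _ ℚ) *ᵥ c.act (Pi.single i ((M : K i) * y)) v₀) j : ℝ)) := by
  set γiR : Matrix (Fin g ⊕ Fin g) (Fin g ⊕ Fin g) ℝ :=
    ((γ⁻¹ : GL (Fin g ⊕ Fin g) ℚ) : Matrix _ _ ℚ).map (algebraMap ℚ ℝ) with hγiR
  -- the real-linear lift `L′ = Ψ ∘ γ⁻¹ ∘ e⁻¹ ∘ ιᵢ ∘ (M·)`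
  let L : ((Φ i).1 → ℂ) →ₗ[ℝ] (Fin g → ℂ) :=
    (Ψ.toLinearEquiv.toLinearMap.comp ((Matrix.mulVecLin γiR).comp
      (e.symm.toLinearMap.comp (LinearMap.single ℝ (fun j : ι => ((Φ j).1 → ℂ)) i)))).comp ((M : ℝ) • LinearMap.id)
  have hL : ∀ w, L w = Ψ (γiR *ᵥ e.symm (Pi.single i ((M : ℝ) • w))) := fun w => rfl
  -- `e⁻¹(i y) = J e⁻¹ y`
  have hesymm : ∀ y, e.symm (Complex.I • y) = J *ᵥ e.symm y := fun y => by
    apply e.injective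
    rw [LinearEquiv.apply_symm_apply, heJ, LinearEquiv.apply_symm_apply]
  have hI : ∀ w, L.toContinuousLinearMap (Complex.I • w) = Complex.I • L.toContinuousLinearMap w := by
    intro w
    have hsingle : (Pi.single i (Complex.I • ((M : ℝ) • w)) : Π j, ((Φ j).1 → ℂ)) =
        Complex.I • (Pi.single i ((M : ℝ) • w) : Π j, ((Φ j).1 → ℂ)) := by
      funext j
      by_cases hj : j = i
      · subst hj; rw [Pi.smul_apply, Pi.single_eq_same, Pi.single_eq_same]
      · rw [Pi.smul_apply, Pi.single_eq_of_ne hj, Pi.single_eq_of_ne hj, smul_zero]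
    rw [LinearMap.coe_toContinuousLinearMap', hL, hL, smul_comm (M : ℝ) Complex.I w, hsingle, hesymm, hΨJ]
  set T : ((Φ i).1 → ℂ) →L[ℂ] (Fin g → ℂ) := toComplexLinear L.toContinuousLinearMap hI with hT
  have hTw : ∀ w, T w = Ψ (γiR *ᵥ e.symm (Pi.single i ((M : ℝ) • w))) := fun w => by
    rw [hT, toComplexLinear_apply, LinearMap.coe_toContinuousLinearMap', hL]
  -- `T (v y) = Ψ (γ⁻¹ act(eᵢ(M y)) v₀)`
  have hTemb : ∀ y : K i, T (cmEmbedding (Φ i) y) =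
      Ψ (fun j => ((((γ⁻¹ : GL (Fin g ⊕ Fin g) ℚ) : Matrix _ _ ℚ) *ᵥ c.act (Pi.single i ((M : K i) * y)) v₀) j : ℝ)) := by
    intro y
    have hM : (M : ℝ) • cmEmbedding (Φ i) y = cmEmbedding (Φ i) ((M : K i) * y) := by
      rw [map_mul, map_natCast, ← nsmul_eq_mul, Nat.cast_smul_eq_nsmul]
    rw [hTw, hM, e_symm_single_cmEmbedding c Φ hv₀ i, realVec_mulVec]
  -- lattice condition: basis vectors of `𝔟′` go to `Ψ(ℤ^{2g})`
  have hTlat : ∀ k : basisIndex 𝔟', ∃ z : Fin g ⊕ Fin g → ℤ, T (periodIso (Φ i) 𝔟' (Pi.single k 1)) = latticeVec Ψ z := by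
    intro k
    have hmem : basisOfFractionalIdeal (K i) 𝔟' k ∈ ((𝔟' : FractionalIdeal (𝓞 (K i))⁰ (K i)) : Set (K i)) := by
      rw [← mem_span_basisOfFractionalIdeal]
      exact Submodule.subset_span ⟨k, rfl⟩
    obtain ⟨z, hz⟩ := hup _ hmem
    refine ⟨z, ?_⟩
    rw [periodIso_single, hTemb, hz]
    simp only [latticeVec, Rat.cast_intCast]
  obtain ⟨θ, hθ⟩ := AbelianVariety.exists_hom_map_cover_eq ξ'.isAnalytification hφB ξ'.toFun_zero hφB0 T hTlat
  refine ⟨θ, fun y => ?_⟩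
  rw [CMTypeUniformization.r_apply, hθ, hTemb, cover_apply_apply]

end CMStructure

end Literature.AlgebraicGeometry.ModuliOfAbelianVarieties

end
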